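import Summits.BirchSwinnertonDyer.Rank1Residual.X11a.PrintDischargeMuAn
import Summits.BirchSwinnertonDyer.Rank1Residual.X11a.InvariantsEndpoint
import Summits.BirchSwinnertonDyer.Rank1Residual.X11a.NormLamEndpoint
import Summits.BirchSwinnertonDyer.Rank1Residual.X11a.ChainHeightFree
import Summits.BirchSwinnertonDyer.Rank1Residual.X2.AnalyticInvariants
import HarnessLib

/-!
# Crux `X11aLowerHalf` (item stmt-BirchSwinnertonDyer-19064), NON-SURJECTIVE sub-leaf: the
# Kato-free ENDPOINT of the EPW chain — `X11b.MultDivisibilityAt` replaces Kato–Wuthrich A32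
# (`--supports stmt-BirchSwinnertonDyer-19064`; seat bsd-line-er5-p2, -w3 width seat of the
# 19064 line, stub territory `stub_lowerNonSurj` ∕ `stub_nonSurjDeepFive`)

HONEST FRAMING. Theorems only; no definition, no named fact, no `sorry`. Nothing here closes the crux
`X11aLowerHalf` (`∀` X11a pairs, OPEN class-wide: Skinner–Urban without (ram) at `p ∥ N`, barrier B3)
or any stub of its registered skeleton; BSD is not proved for any curve or class by this file.

## What

The x11a chain of record (`X11a.forall_bsdp_of_namedFacts_ofLevel_heightFree`,
`X11a/ChainAnyLevel.lean`: on X11a ∩ {`p ≥ 5`, `ρ̄_{E,p}` SURJECTIVE}, `MuAnZeroAt W p ⟹ BSD(E,p)`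
from 12 named facts) uses the surjectivity of `ρ̄_{E,p}` in exactly two places:
(K) Kato–Wuthrich A32 `kato_charIdeal_dvd_multiplicative_of_surjective` — the Kato element lies in
    `char_Λ X(E/ℚ_∞)` INTEGRALLY (three uses: `μ^alg(E) = 0` from the certificate, `X` torsion, and the
    endpoint `mazurMainConjectureAt_of_invariantsMatchAt`);
(W) Wan 2015 Thm. 4 as typed (`Wan2015.thm4_rational_weightK_member_of_bdd_ofLevel`, instance
    restricted to surjective `ρ̄_{E,p}`).
On the NON-surjective X11a sub-leaf (images `5Ns ∕ 5S4 ∕ 7Ns`, `p ∣ ord_p Δ_min`) the K2 cell's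
μ-transfer WITHOUT big image delivers the same integral divisibility from the certificate:
`ClassX11a.multDivisibilityAt_of_muAnZeroAt_of_not_surj : … → X11a.MuAnZeroAt W p →
X11b.MultDivisibilityAt W p` (`X11a/PrintDischargeMuAn.lean` §1, Kato 2004 Thm. 12.4 + §17.13 fine
quotient + Greenberg 1999 Thm. 1.5 + Wuthrich 2014 Cor. 18). THIS FILE re-bases the three (K)-uses of
the chain on the typed divisibility `X11b.MultDivisibilityAt W p` (no image hypothesis, any odd `p`):

* `invariantsAt_dvd_of_multDivisibilityAt` — `fE ∣ g` for every Kato pair (twin of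
  `X11a.invariantsAt_dvd_of_kato`);
* `invariantsAt_hasUnitContent_generator_of_muAnZeroAt_of_multDivisibilityAt` — with the certificate,
  both `g` and the generator `fE` of `char_Λ X` have unit content (twin of
  `X11a.invariantsAt_hasUnitContent_generator_of_muAnZeroAt`);
* `isTorsion_and_mu_eq_zero_of_muAnZeroAt_of_multDivisibilityAt` — `X(E/ℚ_∞)` torsion and
  `μ(X(E/ℚ_∞)) = 0` for every cyclotomic datum and every dual datum (twin of
  `X11a.selmerDual_mu_eq_zero_of_muAnZeroAt`; this is EPW's standing hypothesis `μ^alg = 0` AT THE PAIR);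
* **`mazurMainConjectureAt_of_invariantsMatchAt_of_multDivisibilityAt`** — at a multiplicative `p`
  with `ord_{s=1} L(E,s) = 0`: `X11b.MultDivisibilityAt W p → X11a.InvariantsMatchAt W p →
  X2.MazurMainConjectureAt W p` (twin of `X11a.mazurMainConjectureAt_of_invariantsMatchAt`, same proof,
  Kato's element replaced by the typed divisibility; Greenberg–Stevens `hGS` and modularity `hmod` for
  the non-vanishing `g ≠ 0` exactly as there);
* doors on the class: `ClassX11a.mazurMainConjectureAt_of_invariantsMatchAt_of_muAnZeroAt_of_not_surj`,
  `ClassX11a.bsdp_of_invariantsMatchAt_of_muAnZeroAt_of_not_surj`,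
  `ClassX11a.missingLowerBoundAt_of_bsdp` (the crux-L currency from `BSDp`, GZK for `Ш` finite) and
  `ClassX11a.missingLowerBoundAt_of_invariantsMatchAt_of_muAnZeroAt_of_not_surj`.

What remains displayed at a non-surjective pair after this file: the EPW invariants statement
`X11a.InvariantsMatchAt W p` (supplied by the Hida-family chain of the sibling file
`PrintX11aLowerHalfNonSurjChain.lean` from EPW Thm. 1 ∕ 3.1.1 ∕ 5.1.3 and Wan 2015 Thm. 4 under
(irred)) and the certificate `X11a.MuAnZeroAt W p` (Greenberg's `μ`-conjecture at class level —
the SAME residual object as on the surjective sub-leaf and as crux `X11aNonSurjEulerHalf`).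
beyond-print theorem: no.

References: [Kato2004Asterisque] Thm. 12.4 (p. 221), §17.13 (pp. 279–280); [Wuthrich2014] Cor. 18
(p. 398), Thm. 3 (p. 382); [GreenbergVatsal2000] p. 2–4, (1)–(2); [EmertonPollackWeston2006] Thm.
5.1.2, Thm. 5.1.3; [GreenbergStevens1993] Thm. (0.3); [MazurTateTeitelbaum1986] §I.14–15;
[SteinWuthrich2013] Thm. 6.1 (p. 20); [Miller2011LMS] Def. 1.1; cell files
`pub/bsd-print-x11a/P3-EXCEPTIONAL-ZERO-ROAD.md` §5, `TY2-DISCHARGE-INTERFACE.md` §J.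
-/

set_option autoImplicit false
set_option linter.dupNamespace false -- the directory name repeats the summit name (sibling precedent)

noncomputable section

open scoped Classical MatrixGroups ModularForm

open CongruenceSubgroup WeierstrassCurve Literature.NumberTheory.EllipticCurves
  Literature.NumberTheory.EllipticCurves.ModularForms
  Literature.NumberTheory.EllipticCurves.Rank1Residual
  Literature.NumberTheory.EllipticCurves.Rank1Residual.Typed
  Literature.NumberTheory.EllipticCurves.Wuthrich2014
  Literature.NumberTheory.EllipticCurves.SteinWuthrich2013
  Literature.NumberTheory.EllipticCurves.Greenberg1999
  Literature.NumberTheory.EllipticCurves.Kato2004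
  Literature.NumberTheory.EllipticCurves.GreenbergVatsal2000
  Literature.NumberTheory.EllipticCurves.EmertonPollackWeston2006
  Summit.BirchSwinnertonDyer.Rank1Residual
  Summit.BirchSwinnertonDyer.Rank1Residual.X1.MuLambda
  Summit.BirchSwinnertonDyer.Rank1Residual.X11a

namespace Summit.BirchSwinnertonDyer.BirchSwinnertonDyer.Theorems.NonSurjChain

/-! ### §1 The typed divisibility at the Kato pairs (no image hypothesis) -/

section Divisibility

variable (W : WeierstrassCurve ℚ) [W.IsElliptic] [W.IsGloballyMinimal] (p : ℕ) [Fact p.Prime]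

/-- **The typed divisibility at the Kato pairs**: `X11b.MultDivisibilityAt W p` gives `fE ∣ g` for
every Kato pair `(g, fE)` — SOME `g' ∈ char_Λ X = (fE)` has `ι(T^e g') = ϖ·L_p`, and `ι` is
injective (`T` is not a zero divisor), so `g = g'`. Twin of `X11a.invariantsAt_dvd_of_kato` with the
typed input in place of Kato–Wuthrich A32; no hypothesis on `ρ̄_{E,p}`.
[cite: Kato2004Asterisque, Thm. 12.4 (p. 221) and §17.13 (pp. 279–280)] [cite: Wuthrich2014, Cor. 18 (p. 398)] -/
theorem invariantsAt_dvd_of_multDivisibilityAt (hdiv : X11b.MultDivisibilityAt W p) :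
    InvariantsAt W p fun g fE => fE ∣ g := by
  intro κ γ hκ hγ hγ' N _ f hf D ϖ hϖ fE g hchar
  have hϖ0 : ϖ ≠ 0 := X2.varpi_ne_zero_of_isNewformOf hf hϖ
  obtain ⟨-, hKns, hKs⟩ := hdiv hκ hγ hγ' hf D ϖ hϖ0 hϖ
  have hinj := iwasawaToPowerSeries_injective p
  refine ⟨fun hns L hL hι => ?_, fun hs L hL hι => ?_⟩
  · obtain ⟨g', hg'mem, hι'⟩ := hKns hns L hL
    have hgg' : g = g' := hinj (hι.trans hι'.symm)
    rw [hgg']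
    rw [hchar] at hg'mem
    exact Ideal.mem_span_singleton.mp hg'mem
  · obtain ⟨g', hg'mem, hι'⟩ := hKs hs L hL
    have hXg : (PowerSeries.X : IwasawaAlgebra p) * g = PowerSeries.X * g' :=
      hinj (hι.trans hι'.symm)
    have hgg' : g = g' := mul_left_cancel₀ PowerSeries.X_ne_zero hXg
    rw [hgg']
    rw [hchar] at hg'mem
    exact Ideal.mem_span_singleton.mp hg'mem

/-- **With the certificate `μ^an(E,p) = 0`: both members of every Kato pair have unit content**
(`μ(g) = μ(fE) = 0`): `p ∤ g` from the certificate, `fE ∣ g` from the typed divisibility. Twin of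
`X11a.invariantsAt_hasUnitContent_generator_of_muAnZeroAt`. [cite: GreenbergVatsal2000, p. 2–4, (1)–(2)]
[cite: EmertonPollackWeston2006, Thm. 5.1.2] -/
theorem invariantsAt_hasUnitContent_generator_of_muAnZeroAt_of_multDivisibilityAt
    (hdiv : X11b.MultDivisibilityAt W p) (hμ : MuAnZeroAt W p) :
    InvariantsAt W p fun g fE => HasUnitContent g ∧ HasUnitContent fE ∧ mu g = 0 ∧ mu fE = 0 :=
  ((invariantsAt_hasUnitContent_of_muAnZeroAt W p hμ).and
    (invariantsAt_dvd_of_multDivisibilityAt W p hdiv)).mono fun g fE h => by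
      obtain ⟨hg, ⟨c, hc⟩⟩ := h
      have hfE : HasUnitContent fE := hasUnitContent_left_of_mul (a := fE) (b := c) (hc ▸ hg)
      exact ⟨hg, hfE, mu_eq_zero_of_hasUnitContent hg, mu_eq_zero_of_hasUnitContent hfE⟩

/-- **`X(E/ℚ_∞)` is torsion and `μ(X(E/ℚ_∞)) = 0`** for every cyclotomic datum and every dual datum,
at a multiplicative `p` from the typed divisibility, the certificate and a modular parametrisation
datum (`hpar`, for the newform and `ϖ`; THE Mazur–Tate–Teitelbaum function by the tree existence
theorems). Twin of `X11a.isTorsion_and_exists_generator_hasUnitContent_of_muAnZeroAt` ∘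
`X11a.selmerDual_mu_eq_zero_of_muAnZeroAt`; `D.mu` is the intrinsic `μ` of the Iwasawa module
(`GreenbergVatsal2000.mu_eq_zero_iff_hasUnitContent`). [cite: GreenbergLNM1716, Conj. 1.11 and Thm. 1.5]
[cite: GreenbergVatsal2000, p. 2, (1)–(2)] [cite: Kato2004Asterisque, §17.13 (pp. 279–280)] -/
theorem isTorsion_and_mu_eq_zero_of_muAnZeroAt_of_multDivisibilityAt
    (hpar : nonempty_modularParametrizationData)
    (hmult : W.HasMultiplicativeReductionAtPrime p)
    (hdiv : X11b.MultDivisibilityAt W p) (hμ : MuAnZeroAt W p)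
    {κ : ZpExtension ℚ p} {γ : Field.absoluteGaloisGroup ℚ} (hκ : κ.IsCyclotomic)
    (hγ : κ.IsTopGenerator γ) (hγ' : IsCyclotomicVariable p γ) (D : W.SelmerDualData κ γ) :
    D.IsTorsion ∧ D.mu = 0 := by
  haveI : NeZero (W.conductorNorm ℤ) := ⟨(W.conductorNorm_pos_holds).ne'⟩
  obtain ⟨Dm⟩ := hpar W
  obtain ⟨ϖ, -, hϖ, -⟩ := Dm.exists_rat_mul_realPeriodRat_eq_plusPeriod
  have hϖ0 : ϖ ≠ 0 := X2.varpi_ne_zero_of_isNewformOf Dm.isNewformOf hϖ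
  obtain ⟨hX, hKns, hKs⟩ := hdiv hκ hγ hγ' Dm.isNewformOf D ϖ hϖ0 hϖ
  haveI : (Literature.NumberTheory.EllipticCurves.Module.charIdeal (IwasawaAlgebra p) D.X).IsPrincipal :=
    charIdeal_isPrincipal_holds p D.X
  obtain ⟨fE, hfE⟩ := Submodule.IsPrincipal.principal
    (Literature.NumberTheory.EllipticCurves.Module.charIdeal (IwasawaAlgebra p) D.X)
  have hchar : D.charIdeal = Ideal.span {fE} := hfE
  have key := invariantsAt_hasUnitContent_generator_of_muAnZeroAt_of_multDivisibilityAt W p hdiv hμ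
    κ γ hκ hγ hγ' Dm.f Dm.isNewformOf D ϖ hϖ fE
  have hunit : HasUnitContent fE := by
    by_cases hsplit : W.HasSplitMultiplicativeReductionAtPrime p
    · obtain ⟨L, hL⟩ := exists_isSplitMultPAdicLFunctionOf hsplit Dm.isNewformOf
      obtain ⟨g, -, hι⟩ := hKs hsplit L hL
      exact ((key g hchar).2 hsplit L hL hι).2.1
    · obtain ⟨L, hL⟩ := exists_isMultPAdicLFunctionOf_neg_one_of_nonsplit Dm.isNewformOf hmult hsplit
      obtain ⟨g, -, hι⟩ := hKns hsplit L hL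
      exact ((key g hchar).1 hsplit L hL hι).2.1
  haveI : Module.Finite (IwasawaAlgebra p) D.X := D.module_finite_holds hγ
  exact ⟨hX, (GreenbergVatsal2000.mu_eq_zero_iff_hasUnitContent D hX hchar).mpr hunit⟩

end Divisibility

/-! ### §2 The endpoint: typed divisibility + EPW invariants ⟹ Mazur's main conjecture at the pair -/

section Endpoint

/-- **At a multiplicative `p` with `ord_{s=1} L(E,s) = 0`: `X11b.MultDivisibilityAt W p` and
`X11a.InvariantsMatchAt W p` give Mazur's main conjecture at `(E,p)`** — NO hypothesis on the image of
`ρ̄_{E,p}`. The typed divisibility gives `g = h · f_E ∈ char_Λ X = (f_E)` with `ι(T^e g) = ϖ L_p`;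
the invariants statement gives `μ(g) = μ(f_E)`, `λ(g) = λ(f_E)`, hence `(g) = (f_E)` and `h ∈ Λ^×`
(`X1.MuLambda.span_eq_span_iff_mu_lam`, `span_eq_span_iff_isUnit`); `g ≠ 0` because
`L_p(0) = 2[0]⁺_f ≠ 0` (non-split) resp. `[T¹]L_p · log κ(γ) = 𝓛_p[0]⁺_f ≠ 0` (split:
Greenberg–Stevens `hGS`, `𝓛_p ≠ 0`), `[0]⁺_f ≠ 0` by `r_an = 0` (modularity `hmod`). Twin of
`X11a.mazurMainConjectureAt_of_invariantsMatchAt` (same proof, Kato's element replaced by the typed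
input). [cite: EmertonPollackWeston2006, Thm. 5.1.2 and Thm. 5.1.3]
[cite: GreenbergVatsal2000, p. 4 (after Thm. (1.2))] [cite: GreenbergStevens1993, Thm. (0.3) (p. 407)]
[cite: MazurTateTeitelbaum1986, §I.14–15] -/
theorem mazurMainConjectureAt_of_invariantsMatchAt_of_multDivisibilityAt
    (hmod : hasEntireLFunction_rat)
    (W : WeierstrassCurve ℚ) [W.IsElliptic] [W.IsGloballyMinimal] (p : ℕ) [Fact p.Prime]
    (hGS : greenberg_stevens (W := W) (p := p))
    (hdiv : X11b.MultDivisibilityAt W p) (hr : W.analyticRank = 0)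
    (hinv : InvariantsMatchAt W p) : X2.MazurMainConjectureAt W p := by
  intro κ γ hκ hγ hγ' N _ f hf D ϖ hϖ
  haveI : Module.Finite (IwasawaAlgebra p) D.X := D.module_finite_holds hγ
  have hϖ0 : ϖ ≠ 0 := X2.varpi_ne_zero_of_isNewformOf hf hϖ
  obtain ⟨hX, hKns, hKs⟩ := hdiv hκ hγ hγ' hf D ϖ hϖ0 hϖ
  haveI : (Literature.NumberTheory.EllipticCurves.Module.charIdeal (IwasawaAlgebra p) D.X).IsPrincipal :=
    charIdeal_isPrincipal_holds p D.X
  obtain ⟨fE, hfE⟩ := Submodule.IsPrincipal.principal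
    (Literature.NumberTheory.EllipticCurves.Module.charIdeal (IwasawaAlgebra p) D.X)
  have hchar : D.charIdeal = Ideal.span {fE} := hfE
  -- rank `0`: `[0]⁺_f ≠ 0`
  have hL1 : W.entireLFunction 1 ≠ 0 := (W.analyticRank_eq_zero_iff_holds (hmod W)).1 hr
  set s : ℚ := ratPlusSymbol f 0 with hs_def
  have hLval : W.entireLFunction 1 = (((s : ℝ) * plusPeriod f : ℝ) : ℂ) := hf.entireLFunction_one_eq
  have hs0 : s ≠ 0 := by
    intro h0
    apply hL1
    rw [hLval, h0]
    simp
  have hsQ0 : (s : ℚ_[p]) ≠ 0 := by exact_mod_cast hs0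
  have hϖQ0 : ((ϖ : ℚ) : ℚ_[p]) ≠ 0 := by exact_mod_cast hϖ0
  -- from `(g) = (fE)` with `g = h·fE` to the unit `w`
  have unit_of : ∀ (g h : IwasawaAlgebra p), h * fE = g → g ≠ 0 → mu g = mu fE ∧ lam g = lam fE →
      IsUnit h := by
    intro g h hgh hg0 hml
    have hfE0 : fE ≠ 0 := by
      rintro rfl
      exact hg0 (by rw [← hgh, mul_zero])
    have hfac : g = fE * h := by rw [← hgh, mul_comm]
    have hspan : Ideal.span ({g} : Set (IwasawaAlgebra p)) = Ideal.span {fE} :=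
      (span_eq_span_iff_mu_lam hfE0 hg0 hfac).mpr hml
    exact (span_eq_span_iff_isUnit hfE0 hfac).mp hspan
  refine ⟨hX, fE, hchar, fun hsplit L hL => ?_, fun hns L hL => ?_⟩
  · -- split: `ι(T·g) = ϖ·L`, `[T¹]`: `g(0) = ϖ·[T¹]L ≠ 0`
    obtain ⟨g, hgmem, hιg⟩ := hKs hsplit L hL
    have hgmem' : g ∈ Ideal.span {fE} := by rw [← hchar]; exact hgmem
    obtain ⟨h, hgh⟩ := Ideal.mem_span_singleton'.mp hgmem'
    obtain ⟨Dq⟩ := (nonempty_tateParameterData_iff_holds (W := W) (p := p)).mpr hsplit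
    obtain ⟨-, hGS1⟩ := hGS Dq hf hL
    have h𝓛0 : LInvariant Dq ≠ 0 := LInvariant_ne_zero_holds Dq
    have hc1 : PowerSeries.coeff 1 L ≠ 0 := by
      intro h0
      rw [h0, zero_mul] at hGS1
      exact (mul_ne_zero h𝓛0 hsQ0) hGS1.symm
    have h1 : ((PowerSeries.constantCoeff g : ℤ_[p]) : ℚ_[p]) =
        ((ϖ : ℚ) : ℚ_[p]) * PowerSeries.coeff 1 L := by
      have h := congrArg (PowerSeries.coeff 1) hιg
      rw [iwasawaToPowerSeries, PowerSeries.coeff_map, PowerSeries.coeff_succ_X_mul,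
        PowerSeries.coeff_zero_eq_constantCoeff, PowerSeries.coeff_C_mul] at h
      exact h
    have hg0 : g ≠ 0 := by
      intro h0
      have : ((PowerSeries.constantCoeff g : ℤ_[p]) : ℚ_[p]) = 0 := by
        rw [h0, map_zero, PadicInt.coe_zero]
      rw [h1] at this
      exact (mul_ne_zero hϖQ0 hc1) this
    have hml := (hinv κ γ hκ hγ hγ' f hf D ϖ hϖ fE g hchar).2 hsplit L hL hιg
    have hunit : IsUnit h := unit_of g h hgh hg0 hml
    refine ⟨hunit.unit, ?_⟩
    rw [IsUnit.unit_spec, show (PowerSeries.X : IwasawaAlgebra p) * fE * h = PowerSeries.X * g by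
      rw [← hgh]; ring]
    exact hιg
  · -- non-split: `ι(g) = ϖ·L`, `g(0) = ϖ·2[0]⁺_f ≠ 0`
    obtain ⟨g, hgmem, hιg⟩ := hKns hns L hL
    have hgmem' : g ∈ Ideal.span {fE} := by rw [← hchar]; exact hgmem
    obtain ⟨h, hgh⟩ := Ideal.mem_span_singleton'.mp hgmem'
    have hL0 : PowerSeries.constantCoeff L = 2 * (s : ℚ_[p]) := hL.constantCoeff_of_neg_one
    have h1 : ((PowerSeries.constantCoeff g : ℤ_[p]) : ℚ_[p]) =
        ((ϖ : ℚ) : ℚ_[p]) * (2 * (s : ℚ_[p])) := by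
      have h := congrArg PowerSeries.constantCoeff hιg
      rw [constantCoeff_iwasawaToPowerSeries, map_mul, PowerSeries.constantCoeff_C, hL0] at h
      exact h
    have hg0 : g ≠ 0 := by
      intro h0
      have : ((PowerSeries.constantCoeff g : ℤ_[p]) : ℚ_[p]) = 0 := by
        rw [h0, map_zero, PadicInt.coe_zero]
      rw [h1] at this
      exact (mul_ne_zero hϖQ0 (mul_ne_zero two_ne_zero hsQ0)) this
    have hml := (hinv κ γ hκ hγ hγ' f hf D ϖ hϖ fE g hchar).1 hns L hL hιg
    have hunit : IsUnit h := unit_of g h hgh hg0 hml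
    refine ⟨hunit.unit, ?_⟩
    rw [IsUnit.unit_spec, show fE * h = g by rw [← hgh]; ring]
    exact hιg

/-- **Hence, with NO image hypothesis, at a multiplicative `p` in analytic rank `0`:
`X11b.MultDivisibilityAt W p → (X11a.InvariantsMatchAt W p ↔ X2.MazurMainConjectureAt W p)`** (the
converse is the tree's pure-algebra `X11a.invariantsMatchAt_of_mazurMainConjectureAt`).
[cite: EmertonPollackWeston2006, Thm. 5.1.2 and Thm. 5.1.3] [cite: GreenbergVatsal2000, p. 4 (after Thm. (1.2))] -/
theorem invariantsMatchAt_iff_mazurMainConjectureAt_of_multDivisibilityAt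
    (hmod : hasEntireLFunction_rat)
    (W : WeierstrassCurve ℚ) [W.IsElliptic] [W.IsGloballyMinimal] (p : ℕ) [Fact p.Prime]
    (hGS : greenberg_stevens (W := W) (p := p))
    (hdiv : X11b.MultDivisibilityAt W p) (hr : W.analyticRank = 0) :
    InvariantsMatchAt W p ↔ X2.MazurMainConjectureAt W p :=
  ⟨mazurMainConjectureAt_of_invariantsMatchAt_of_multDivisibilityAt hmod W p hGS hdiv hr,
    invariantsMatchAt_of_mazurMainConjectureAt W p⟩

end Endpoint

/-! ### §3 Doors on the class `ClassX11a`, NON-surjective image (any odd `p`) -/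

section Doors

variable {W : WeierstrassCurve ℚ} [W.IsElliptic] [W.IsGloballyMinimal] {p : ℕ} [Fact p.Prime]

/-- **The crux-L currency from `BSD(E,p)` on X11a**: `BSDp W p → Typed.MissingLowerBoundAt W p`
(`Ш(E/ℚ)` is finite in analytic rank `0`, GZK `hGZK`, so `ord_p #Ш(p) = ord_p #Ш`).
[cite: Miller2011LMS, §1 and Def. 1.1 (arXiv:1010.2431 p. 3)] -/
theorem _root_.Summit.BirchSwinnertonDyer.Rank1Residual.ClassX11a.missingLowerBoundAt_of_bsdp
    (hGZK : rank_eq_analyticRank_of_analyticRank_le_one) (hX : ClassX11a W p) (h : BSDp W p) :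
    MissingLowerBoundAt W p := by
  haveI : Finite W.sha := (hGZK W hX.analyticRank_le_one).2
  exact (lower_and_upper_of_missingPPartAt W p (missingPPartAt_of_bsdp W p h)).1

/-- **Mazur's main conjecture at a NON-surjective X11a pair from the certificate `μ^an(E,p) = 0` and
EPW's invariants statement**, modulo Kato 2004 Thm. 12.4 (`h12`), the three §17.13 construction facts
(`hns`, `hsp`, `hfine`), Greenberg 1999 Thm. 1.5 (`h15`), Wuthrich 2014 Cor. 18 (`h18`), a modular
parametrisation (`hpar`, also giving the entire continuation) and Greenberg–Stevens at the pair
(`hGS`): §2 ∘ `ClassX11a.multDivisibilityAt_of_muAnZeroAt_of_not_surj`. PER PAIR, conditional on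
the displayed facts; closes nothing class-wide. [cite: Kato2004Asterisque, Thm. 12.4 (p. 221), §17.13 (pp. 279–280)]
[cite: Wuthrich2014, Cor. 18 (p. 398)] [cite: EmertonPollackWeston2006, Thm. 5.1.3]
[cite: GreenbergStevens1993, Thm. (0.3) (p. 407)] -/
theorem _root_.Summit.BirchSwinnertonDyer.Rank1Residual.ClassX11a.mazurMainConjectureAt_of_invariantsMatchAt_of_muAnZeroAt_of_not_surj
    (hpar : nonempty_modularParametrizationData)
    (h12 : Kato2004.thm12_4)
    (hns : Kato2004.exists_multDivisibilityInputs_nonsplit)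
    (hsp : Kato2004.exists_multDivisibilityInputs_split)
    (h15 : thm15_isTorsion_multiplicative_rat)
    (h18 : Wuthrich2014.corollary18_padicLFunction_mem_iwasawaAlgebra_multiplicative)
    (hfine : Kato2004.exists_multDivisibilityInputs_fine)
    (hGS : greenberg_stevens (W := W) (p := p))
    (hX : ClassX11a W p) (hnsj : ¬ Surj W p) (hμ : X11a.MuAnZeroAt W p)
    (hinv : InvariantsMatchAt W p) : X2.MazurMainConjectureAt W p :=
  mazurMainConjectureAt_of_invariantsMatchAt_of_multDivisibilityAt
    (X2.ClassClosureEntireFree.hasEntireLFunction_rat_of_nonempty_modularParametrizationData hpar) W p hGS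
    (hX.multDivisibilityAt_of_muAnZeroAt_of_not_surj h12 hns hsp h15 h18 hfine hnsj hμ)
    hX.analyticRank_eq_zero hinv

/-- **`BSD(E,p)` at a NON-surjective X11a pair from the certificate and EPW's invariants statement**,
modulo the ten facts above + Stein–Wuthrich 2013 Thm. 6.1 split ∕ non-split (`hJs`, `hJn`) and GZK
(`hGZK`): the previous door through the height-free rank-`0` socket
`X11a.bsdp_of_mazurMainConjectureAt_heightFree`. BOTH Miller halves at once — no `hlow` binder (cf.
`ClassX11a.bsdp_of_muAnZeroAt_of_not_surj`, which still took the lower half `MissingLowerBoundAt W p`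
as a hypothesis). PER PAIR; closes nothing class-wide. [cite: SteinWuthrich2013, Thm. 6.1 (p. 20)]
[cite: Miller2011LMS, §1 and Def. 1.1] [cite: Kato2004Asterisque, §17.13 (pp. 279–280)]
[cite: EmertonPollackWeston2006, Thm. 5.1.3] -/
theorem _root_.Summit.BirchSwinnertonDyer.Rank1Residual.ClassX11a.bsdp_of_invariantsMatchAt_of_muAnZeroAt_of_not_surj
    (hJs : thm61_splitMultiplicative) (hJn : thm61_nonsplitMultiplicative)
    (hGZK : rank_eq_analyticRank_of_analyticRank_le_one) (hpar : nonempty_modularParametrizationData)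
    (h12 : Kato2004.thm12_4)
    (hns : Kato2004.exists_multDivisibilityInputs_nonsplit)
    (hsp : Kato2004.exists_multDivisibilityInputs_split)
    (h15 : thm15_isTorsion_multiplicative_rat)
    (h18 : Wuthrich2014.corollary18_padicLFunction_mem_iwasawaAlgebra_multiplicative)
    (hfine : Kato2004.exists_multDivisibilityInputs_fine)
    (hGS : greenberg_stevens (W := W) (p := p))
    (hX : ClassX11a W p) (hnsj : ¬ Surj W p) (hμ : X11a.MuAnZeroAt W p)
    (hinv : InvariantsMatchAt W p) : BSDp W p :=
  bsdp_of_mazurMainConjectureAt_heightFree hJs hJn hGZK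
    (X2.ClassClosureEntireFree.hasEntireLFunction_rat_of_nonempty_modularParametrizationData hpar) hpar hGS hX
    (hX.mazurMainConjectureAt_of_invariantsMatchAt_of_muAnZeroAt_of_not_surj hpar h12 hns hsp h15 h18 hfine
      hGS hnsj hμ hinv)

/-- **The crux-L currency at a NON-surjective X11a pair** (`Typed.MissingLowerBoundAt W p`, the body
of `X11aLowerHalf` at the pair) from the certificate and EPW's invariants statement, modulo the twelve
facts + Greenberg–Stevens. PER PAIR; closes nothing class-wide. [cite: Miller2011LMS, §1 and Def. 1.1]
[cite: SteinWuthrich2013, Thm. 6.1 (p. 20)] [cite: Kato2004Asterisque, §17.13 (pp. 279–280)] -/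
theorem _root_.Summit.BirchSwinnertonDyer.Rank1Residual.ClassX11a.missingLowerBoundAt_of_invariantsMatchAt_of_muAnZeroAt_of_not_surj
    (hJs : thm61_splitMultiplicative) (hJn : thm61_nonsplitMultiplicative)
    (hGZK : rank_eq_analyticRank_of_analyticRank_le_one) (hpar : nonempty_modularParametrizationData)
    (h12 : Kato2004.thm12_4)
    (hns : Kato2004.exists_multDivisibilityInputs_nonsplit)
    (hsp : Kato2004.exists_multDivisibilityInputs_split)
    (h15 : thm15_isTorsion_multiplicative_rat)
    (h18 : Wuthrich2014.corollary18_padicLFunction_mem_iwasawaAlgebra_multiplicative)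
    (hfine : Kato2004.exists_multDivisibilityInputs_fine)
    (hGS : greenberg_stevens (W := W) (p := p))
    (hX : ClassX11a W p) (hnsj : ¬ Surj W p) (hμ : X11a.MuAnZeroAt W p)
    (hinv : InvariantsMatchAt W p) : MissingLowerBoundAt W p :=
  hX.missingLowerBoundAt_of_bsdp hGZK
    (hX.bsdp_of_invariantsMatchAt_of_muAnZeroAt_of_not_surj hJs hJn hGZK hpar h12 hns hsp h15 h18 hfine hGS
      hnsj hμ hinv)

end Doors

end Summit.BirchSwinnertonDyer.BirchSwinnertonDyer.Theorems.NonSurjChain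

end
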